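import Literature.NumberTheory.EllipticCurves.SqrtTwoTwistPointCount
import Literature.NumberTheory.EllipticCurves.QuarticTwistLSeriesCoefficients
import HarnessLib

/-!
# The Dirichlet coefficients of `L(B_n, s)`, `B_n : y² = x³ + 4n x² + 2n² x`, at prime powers

Topic `Literature/NumberTheory/EllipticCurves`, namespace `Literature.NumberTheory.EllipticCurves.SqrtTwoTwist` (sequel to
`SqrtTwoTwistPointCount`).  THEOREMS ONLY (no definition, no named fact).  The `ℤ[√-2]`-twin of
`QuarticTwistLSeriesCoefficients` (`y² = x³ − Dx`, `ℤ[i]`): for Mathlib's `WeierstrassCurve.LFunction` of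
`B_n = ⟨0, 4n, 0, 2n², 0⟩ / ℚ` with `n ∈ ℤ ∖ 0` ODD AND SQUARE-FREE (the models `y² = x(x² − 4ax + 2a²)`, `a = −n`, of Rajwade's
curves with complex multiplication by `ℤ[√-2]`, `j = 8000`; `Δ = 2⁹ n⁶`, `c₄ = 2⁵·5·n²`):

* §1 **additive primes** `p ∣ 2n`: the equation is minimal at `p` with `0 < ord_p Δ < 12` (`ord_p Δ = 6` at an odd `p ∥ n`,
  `ord₂ Δ = 9`) and `ord_p c₄ > 0` (Silverman VII.1.1, VII.5.1(c)), so `B_n` has additive reduction at `p` and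
  `a_{p^{k+1}}(B_n) = 0` (`lFunction_B_apply_prime_pow_of_dvd`);
* §2 **inert primes** `p ≡ 5, 7 (mod 8)`, `p ∤ n`: `a_p = 0` (`SqrtTwoTwistPointCount`, Williams 1978), hence
  `a_{p^{2m}} = (−p)^m`, `a_{p^{2m+1}} = 0` — the Euler factor `(1 + p^{1−2s})⁻¹ = (1 − χ((p)) N(p)^{−s})⁻¹`, `χ((p)) = −p`
  (`lFunction_B_apply_prime_pow_of_inert`);
* §3 **split primes** (any good prime `p ∤ 2n`), generically in the value of `a_p`: if `a_p(B_n) = π + σ` and `p = πσ` in a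
  commutative ring `R`, then `a_{p^k}(B_n) = Σ_{j ≤ k} π^j σ^{k−j}` (`lFunction_B_apply_prime_pow_of_split`; the recursion
  `a_{p^{k+2}} = a_p a_{p^{k+1}} − p a_{p^k}` at a good prime, Diamond–Shurman (8.44), and the tree's `sum_pow_mul_pow_rec`).
  The VALUE `a_p = −(−n/p)·2c = ψ(π) + ψ(π̄)` at `p ≡ 1, 3 (mod 8)` is Brewer's theorem (`SqrtTwoTwistBrewer`, named fact) and is
  not used here.

These are the Euler factors of `L(B_n, s) = L(s, ψ_{B_n})` (Deuring; Rajwade 1968 Thm. 1 for this family) read on Mathlib's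
arithmetic function `m ↦ a_m(B_n)`; the regrouping over the ideals of `ℤ[√-2]` is the sequel `SqrtTwoTwistHeckeCoefficients`.
The case of EVEN `n` (`ord₂ Δ = 15`, where Silverman's Remark VII.1.1 does not decide minimality at `2`) is not treated; the
curves `B_{−2m}` are `2`-isogenous over `ℚ` to `B_m` (the `[√-2]`-isogeny, Silverman AEC III.4.5) and inherit their
`L`-function by the tree's `LFunction_eq_of_isIsogenous_holds`.  Nothing about BSD is proved here.

## References
* A. R. Rajwade, *Arithmetic on curves with complex multiplication by √−2*, Proc. Cambridge Philos. Soc. 64 (1968), Thm. 1.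
  [Rajwade1968]
* J. H. Silverman, *The Arithmetic of Elliptic Curves*, 2nd ed. (2009), VII.1 Remark 1.1, VII.5 Prop. 5.1, §C.16. [SilvermanAEC2009]
* F. Diamond, J. Shurman, *A First Course in Modular Forms*, GTM 228, §8.8 (8.44). [DiamondShurman2005]
* K. Ireland, M. Rosen, *A Classical Introduction to Modern Number Theory*, 2nd ed., Ch. 18 §6 (proof of Theorem 7, the model
  followed). [IrelandRosen1990]

## Mathlib / tree search
Tree: `SqrtTwoTwist.{map_int_rat, Δ_B, c₄_B, not_dvd_Δ_B_int, lFunction_B_apply_prime_eq_zero}` (`SqrtTwoTwistPointCount`),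
`hasAdditiveReductionAt_of_valuation`, `lFunction_apply_eq_zero_of_hasAdditiveReductionAt` (`CongruentNumberCurveAdditiveReduction`),
`hasGoodReductionAt_map_of_not_dvd`, `WeierstrassCurve.LFunction_apply_prime_pow_add_two`, `isMultiplicative_LFunction`,
`GaussianPrimary.sum_pow_mul_pow_rec`, `Rat.valuation_intCast_eq_one/_natGenerator/_intCast_le/_intCast_le_one`.
-/

noncomputable section

open scoped Classical

namespace Literature.NumberTheory.EllipticCurves

namespace SqrtTwoTwist

open WeierstrassCurve IsDedekindDomain Rat.HeightOneSpectrum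
open Literature.NumberTheory.GaloisRepresentations Literature.NumberTheory.QuadraticFields

variable {n : ℤ}

/-! ### §1 The additive primes `p ∣ 2n` (`n` odd and square-free) -/

section Additive

variable (v : HeightOneSpectrum (NumberField.RingOfIntegers ℚ))

/-- The coefficients `4n`, `2n²` of `B_n` are `v`-integral. [cite: SilvermanAEC2009, VII.1 Remark 1.1] -/
private theorem valuation_coeff_le_one (n : ℤ) :
    v.valuation ℚ (4 * (n : ℚ)) ≤ 1 ∧ v.valuation ℚ (2 * (n : ℚ) ^ 2) ≤ 1 := by
  constructor
  · have := Rat.valuation_intCast_le_one v (4 * n)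
    push_cast at this; exact this
  · have := Rat.valuation_intCast_le_one v (2 * n ^ 2)
    push_cast at this; exact this

/-- `v(n) = ϖ` at a prime `p ∣ n` of a square-free `n` (`p ∥ n`). [cite: SilvermanAEC2009, VII.1 Remark 1.1] -/
private theorem valuation_eq_exp_neg_one_of_squarefree (hn : Squarefree n) (hpn : (natGenerator v : ℤ) ∣ n) :
    v.valuation ℚ (n : ℚ) = WithZero.exp (-1 : ℤ) := by
  obtain ⟨m, rfl⟩ := hpn
  have hp := prime_natGenerator v
  have hpm : ¬ (natGenerator v : ℤ) ∣ m := by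
    rintro ⟨k, rfl⟩
    have hsq : (natGenerator v : ℤ) * natGenerator v ∣ natGenerator v * (natGenerator v * k) :=
      ⟨k, by ring⟩
    have h1 := hn (natGenerator v : ℤ) hsq
    rw [Int.isUnit_iff] at h1
    rcases h1 with h1 | h1
    · exact hp.ne_one (by exact_mod_cast h1)
    · have : (0 : ℤ) ≤ natGenerator v := by positivity
      omega
  push_cast
  rw [Valuation.map_mul, Rat.valuation_natGenerator, Rat.valuation_intCast_eq_one v hpm, mul_one]

/-- **`B_n` has additive reduction at every odd prime `p ∣ n`** (`n` square-free): the equation `y² = x³ + 4nx² + 2n²x` is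
`p`-integral with `ord_p Δ = ord_p(2⁹ n⁶) = 6 ∈ (0, 12)` — so minimal at `p` — and `ord_p c₄ = ord_p(160 n²) ≥ 2 > 0`
(Silverman VII.1 Remark 1.1, VII.5 Prop. 5.1(c)). [cite: SilvermanAEC2009, VII.5 Prop. 5.1(c) and VII.1 Remark 1.1] -/
theorem hasAdditiveReductionAt_B_of_odd (hn : Squarefree n) (hp2 : natGenerator v ≠ 2)
    (hpn : (natGenerator v : ℤ) ∣ n) :
    (⟨0, 4 * (n : ℚ), 0, 2 * (n : ℚ) ^ 2, 0⟩ : WeierstrassCurve ℚ).HasAdditiveReductionAt v := by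
  have hp := prime_natGenerator v
  have hvn := valuation_eq_exp_neg_one_of_squarefree v hn hpn
  have h512 : v.valuation ℚ (512 : ℚ) = 1 := by
    have h : ¬ (natGenerator v : ℤ) ∣ 512 := by
      intro h
      have h' : natGenerator v ∣ 2 ^ 9 := by exact_mod_cast h
      exact hp2 ((Nat.prime_dvd_prime_iff_eq hp Nat.prime_two).mp (hp.dvd_of_dvd_pow h'))
    have := Rat.valuation_intCast_eq_one v (n := 512) h
    exact_mod_cast this
  have hΔ : v.valuation ℚ (⟨0, 4 * (n : ℚ), 0, 2 * (n : ℚ) ^ 2, 0⟩ : WeierstrassCurve ℚ).Δ = WithZero.exp (-(6 : ℤ)) := by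
    rw [Δ_B, Valuation.map_mul, Valuation.map_pow, h512, hvn, one_mul, ← WithZero.exp_nsmul]
    norm_num
  have hc₄ : v.valuation ℚ (⟨0, 4 * (n : ℚ), 0, 2 * (n : ℚ) ^ 2, 0⟩ : WeierstrassCurve ℚ).c₄ < 1 := by
    rw [c₄_B, Valuation.map_mul, Valuation.map_pow, hvn, ← WithZero.exp_nsmul]
    have h160 : v.valuation ℚ (160 : ℚ) ≤ 1 := by
      have := Rat.valuation_intCast_le_one v 160
      exact_mod_cast this
    calc v.valuation ℚ (160 : ℚ) * WithZero.exp (2 • (-1 : ℤ)) ≤ 1 * WithZero.exp (2 • (-1 : ℤ)) := by gcongr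
      _ < 1 := by rw [one_mul, ← WithZero.exp_zero, WithZero.exp_lt_exp]; norm_num
  obtain ⟨h2c, h4c⟩ := valuation_coeff_le_one v n
  refine hasAdditiveReductionAt_of_valuation v _ (by simp) h2c (by simp) h4c (by simp) ?_ ?_ hc₄
  · rw [hΔ, WithZero.exp_lt_exp]; norm_num
  · rw [hΔ, ← WithZero.exp_zero, WithZero.exp_lt_exp]; norm_num

/-- **`B_n` has additive reduction at `2` for odd `n`**: `ord₂ Δ = ord₂(2⁹ n⁶) = 9 ∈ (0, 12)` and `ord₂ c₄ = ord₂(2⁵·5·n²) = 5 > 0`.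
[cite: SilvermanAEC2009, VII.5 Prop. 5.1(c) and VII.1 Remark 1.1] -/
theorem hasAdditiveReductionAt_B_two (hodd : Odd n) (hv : natGenerator v = 2) :
    (⟨0, 4 * (n : ℚ), 0, 2 * (n : ℚ) ^ 2, 0⟩ : WeierstrassCurve ℚ).HasAdditiveReductionAt v := by
  have hvn : v.valuation ℚ (n : ℚ) = 1 := by
    refine Rat.valuation_intCast_eq_one v ?_
    rw [hv]
    intro h
    exact Int.not_even_iff_odd.mpr hodd (even_iff_two_dvd.mpr (by exact_mod_cast h))
  have h2 : v.valuation ℚ (2 : ℚ) = WithZero.exp (-1 : ℤ) := by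
    have := Rat.valuation_natGenerator v
    rw [hv] at this; exact_mod_cast this
  have hΔ : v.valuation ℚ (⟨0, 4 * (n : ℚ), 0, 2 * (n : ℚ) ^ 2, 0⟩ : WeierstrassCurve ℚ).Δ = WithZero.exp (-(9 : ℤ)) := by
    rw [Δ_B, Valuation.map_mul, Valuation.map_pow, hvn, one_pow, mul_one, show (512 : ℚ) = 2 ^ 9 by norm_num,
      Valuation.map_pow, h2, ← WithZero.exp_nsmul]
    norm_num
  have hc₄ : v.valuation ℚ (⟨0, 4 * (n : ℚ), 0, 2 * (n : ℚ) ^ 2, 0⟩ : WeierstrassCurve ℚ).c₄ < 1 := by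
    rw [c₄_B, Valuation.map_mul, Valuation.map_pow, hvn, one_pow, mul_one, show (160 : ℚ) = 2 ^ 5 * 5 by norm_num,
      Valuation.map_mul, Valuation.map_pow, h2, ← WithZero.exp_nsmul]
    have h5 : v.valuation ℚ (5 : ℚ) ≤ 1 := by
      have := Rat.valuation_intCast_le_one v 5
      exact_mod_cast this
    calc WithZero.exp (5 • (-1 : ℤ)) * v.valuation ℚ (5 : ℚ) ≤ WithZero.exp (5 • (-1 : ℤ)) * 1 := by gcongr
      _ < 1 := by rw [mul_one, ← WithZero.exp_zero, WithZero.exp_lt_exp]; norm_num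
  obtain ⟨h2c, h4c⟩ := valuation_coeff_le_one v n
  refine hasAdditiveReductionAt_of_valuation v _ (by simp) h2c (by simp) h4c (by simp) ?_ ?_ hc₄
  · rw [hΔ, WithZero.exp_lt_exp]; norm_num
  · rw [hΔ, ← WithZero.exp_zero, WithZero.exp_lt_exp]; norm_num

/-- **`B_n` has additive reduction at every prime `p ∣ 2n`**, for `n` odd and square-free.
[cite: SilvermanAEC2009, VII.5 Prop. 5.1(c) and VII.1 Remark 1.1] -/
theorem hasAdditiveReductionAt_B_of_dvd (hn : Squarefree n) (hodd : Odd n) (hpn : (natGenerator v : ℤ) ∣ 2 * n) :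
    (⟨0, 4 * (n : ℚ), 0, 2 * (n : ℚ) ^ 2, 0⟩ : WeierstrassCurve ℚ).HasAdditiveReductionAt v := by
  by_cases hv : natGenerator v = 2
  · exact hasAdditiveReductionAt_B_two v hodd hv
  · refine hasAdditiveReductionAt_B_of_odd v hn hv ?_
    have hp' : Prime (natGenerator v : ℤ) := Nat.prime_iff_prime_int.mp (prime_natGenerator v)
    rcases hp'.dvd_or_dvd hpn with h2 | h
    · exfalso
      have : natGenerator v ∣ 2 := by exact_mod_cast h2
      exact hv ((Nat.prime_dvd_prime_iff_eq (prime_natGenerator v) Nat.prime_two).mp this)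
    · exact h

/-- **`a_{p^{k+1}}(B_n) = 0` for `p ∣ 2n`** (`n` odd square-free): additive reduction, Euler factor `1` (Rajwade: the `L`-series
of `y² = x(x² − 4ax + 2a²)` is supported on the ideals prime to `2a`). [cite: Rajwade1968, Thm. 1] [cite: SilvermanAEC2009, §C.16 (definition of L_v(T))] -/
theorem lFunction_B_apply_prime_pow_of_dvd (hn : Squarefree n) (hodd : Odd n) {p : ℕ} (hp : p.Prime)
    (hpn : (p : ℤ) ∣ 2 * n) (k : ℕ) :
    (⟨0, 4 * (n : ℚ), 0, 2 * (n : ℚ) ^ 2, 0⟩ : WeierstrassCurve ℚ).LFunction (p ^ (k + 1)) = 0 := by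
  set v : HeightOneSpectrum (NumberField.RingOfIntegers ℚ) := primesEquiv.symm ⟨p, hp⟩ with hvdef
  have hvp : (primesEquiv v : ℕ) = p := by rw [hvdef, Equiv.apply_symm_apply]
  have hadd : (⟨0, 4 * (n : ℚ), 0, 2 * (n : ℚ) ^ 2, 0⟩ : WeierstrassCurve ℚ).HasAdditiveReductionAt v :=
    hasAdditiveReductionAt_B_of_dvd v hn hodd (by rw [show natGenerator v = p from hvp]; exact hpn)
  have h1 : (⟨0, 4 * (n : ℚ), 0, 2 * (n : ℚ) ^ 2, 0⟩ : WeierstrassCurve ℚ).LFunction p = 0 := by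
    have := lFunction_apply_eq_zero_of_hasAdditiveReductionAt v _ hadd
    rwa [hvp] at this
  induction k using Nat.strong_induction_on with
  | _ k ih =>
    rcases k with _ | k
    · rw [zero_add, pow_one]; exact h1
    · have h := (⟨0, 4 * (n : ℚ), 0, 2 * (n : ℚ) ^ 2, 0⟩ : WeierstrassCurve ℚ).LFunction_apply_prime_pow_add_two v k
      rw [hvp, if_neg hadd.not_hasGoodReductionAt, h1, zero_mul, zero_mul, sub_zero] at h
      exact h

end Additive

/-! ### §2 The inert primes `p ≡ 5, 7 (mod 8)`, `p ∤ n` -/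

section Inert

/-- `p ∤ 2n` for an odd prime `p ∤ n`. [cite: Rajwade1968, Thm. 1] -/
private theorem not_dvd_two_mul {p : ℕ} (hp : p.Prime) (hp2 : p ≠ 2) (hpn : ¬ (p : ℤ) ∣ n) : ¬ (p : ℤ) ∣ 2 * n := by
  intro h
  rcases (Nat.prime_iff_prime_int.mp hp).dvd_or_dvd h with h2 | h2
  · have : p ∣ 2 := by exact_mod_cast h2
    exact hp2 ((Nat.prime_dvd_prime_iff_eq hp Nat.prime_two).mp this)
  · exact hpn h2

/-- `B_n` has good reduction at the place over a prime `p ∤ 2n`. [cite: Rajwade1968, Thm. 1] [cite: SilvermanAEC2009, VII.5 Prop. 5.1(a)] -/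
theorem hasGoodReductionAt_B (v : HeightOneSpectrum (NumberField.RingOfIntegers ℚ))
    (h : ¬ ((primesEquiv v : ℕ) : ℤ) ∣ 2 * n) :
    (⟨0, 4 * (n : ℚ), 0, 2 * (n : ℚ) ^ 2, 0⟩ : WeierstrassCurve ℚ).HasGoodReductionAt v := by
  rw [← map_int_rat]
  exact hasGoodReductionAt_map_of_not_dvd _ v (not_dvd_Δ_B_int (primesEquiv v).2 h)

/-- **The inert Euler factor `(1 + p^{1−2s})⁻¹`**: for `p ≡ 5, 7 (mod 8)`, `p ∤ n`: `a_{p^{2m}}(B_n) = (−p)^m` and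
`a_{p^{2m+1}}(B_n) = 0` (`a_p = 0` by Williams' theorem and the good-reduction recursion `a_{p^{k+2}} = a_p a_{p^{k+1}} − p a_{p^k}`).
[cite: Rajwade1968, Thm. 1] [cite: DiamondShurman2005, §8.8 (8.44)] -/
theorem lFunction_B_apply_prime_pow_of_inert {p : ℕ} (hp : p.Prime) (hp8 : p % 8 = 5 ∨ p % 8 = 7)
    (hpn : ¬ (p : ℤ) ∣ n) (m : ℕ) :
    (⟨0, 4 * (n : ℚ), 0, 2 * (n : ℚ) ^ 2, 0⟩ : WeierstrassCurve ℚ).LFunction (p ^ (2 * m)) = (-(p : ℤ)) ^ m ∧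
      (⟨0, 4 * (n : ℚ), 0, 2 * (n : ℚ) ^ 2, 0⟩ : WeierstrassCurve ℚ).LFunction (p ^ (2 * m + 1)) = 0 := by
  have hp2 : p ≠ 2 := by rintro rfl; norm_num at hp8
  have hp2n := not_dvd_two_mul hp hp2 hpn
  set E : WeierstrassCurve ℚ := ⟨0, 4 * (n : ℚ), 0, 2 * (n : ℚ) ^ 2, 0⟩ with hE
  set v : HeightOneSpectrum (NumberField.RingOfIntegers ℚ) := primesEquiv.symm ⟨p, hp⟩ with hvdef
  have hvp : (primesEquiv v : ℕ) = p := by rw [hvdef, Equiv.apply_symm_apply]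
  have hgood : E.HasGoodReductionAt v := hasGoodReductionAt_B v (by rw [hvp]; exact hp2n)
  have h0 : E.LFunction p = 0 := lFunction_B_apply_prime_eq_zero hp hp8 hpn
  have hrec : ∀ k, E.LFunction (p ^ (k + 2)) = -(p : ℤ) * E.LFunction (p ^ k) := by
    intro k
    have h := E.LFunction_apply_prime_pow_add_two v k
    rw [hvp, if_pos hgood, h0, zero_mul, zero_sub] at h
    rw [h]; ring
  induction m with
  | zero =>
    refine ⟨?_, ?_⟩
    · rw [mul_zero, pow_zero, pow_zero]; exact E.isMultiplicative_LFunction.map_one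
    · rw [mul_zero, zero_add, pow_one]; exact h0
  | succ m ih =>
    refine ⟨?_, ?_⟩
    · rw [show 2 * (m + 1) = 2 * m + 2 by ring, hrec, ih.1]; ring
    · rw [show 2 * (m + 1) + 1 = (2 * m + 1) + 2 by ring, hrec, ih.2]; ring

end Inert

/-! ### §3 Good primes: `a_{p^k} = Σ_{j ≤ k} π^j σ^{k−j}` whenever `a_p = π + σ`, `p = πσ` -/

section Split

/-- **The split Euler factor `(1 − π p^{−s})(1 − σ p^{−s})`, generically**: at a prime `p ∤ 2n` (good reduction), if
`a_p(B_n) = π + σ` and `p = πσ` in a commutative ring `R`, then `a_{p^k}(B_n) = Σ_{j=0}^{k} π^j σ^{k−j}` for every `k`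
(«`1 − a_p p^{−s} + p^{1−2s} = (1 − χ(P)NP^{−s})(1 − χ(P̄)NP̄^{−s})`»: the recursion `a_{p^{k+2}} = a_p a_{p^{k+1}} − p a_{p^k}` and
`GaussianPrimary.sum_pow_mul_pow_rec`).  The values `π = ψ(𝔭)`, `σ = ψ(𝔭̄)` at `p ≡ 1, 3 (mod 8)` come from Brewer's theorem
(`SqrtTwoTwistBrewer`); at `p ≡ 5, 7 (mod 8)` one may take `π = √-p`, `σ = −√-p` formally (§2).
[cite: IrelandRosen1990, Ch. 18 §6, proof of Theorem 7 (PDF p. 304)] [cite: DiamondShurman2005, §8.8 (8.44)] -/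
theorem lFunction_B_apply_prime_pow_of_split {R : Type*} [CommRing R] {p : ℕ} (hp : p.Prime) (hp2 : p ≠ 2)
    (hpn : ¬ (p : ℤ) ∣ n) {π σ : R}
    (h1 : (((⟨0, 4 * (n : ℚ), 0, 2 * (n : ℚ) ^ 2, 0⟩ : WeierstrassCurve ℚ).LFunction p : ℤ) : R) = π + σ)
    (hpπσ : (p : R) = π * σ) (k : ℕ) :
    (((⟨0, 4 * (n : ℚ), 0, 2 * (n : ℚ) ^ 2, 0⟩ : WeierstrassCurve ℚ).LFunction (p ^ k) : ℤ) : R) =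
      ∑ j ∈ Finset.range (k + 1), π ^ j * σ ^ (k - j) := by
  have hp2n := not_dvd_two_mul hp hp2 hpn
  set E : WeierstrassCurve ℚ := ⟨0, 4 * (n : ℚ), 0, 2 * (n : ℚ) ^ 2, 0⟩ with hE
  set v : HeightOneSpectrum (NumberField.RingOfIntegers ℚ) := primesEquiv.symm ⟨p, hp⟩ with hvdef
  have hvp : (primesEquiv v : ℕ) = p := by rw [hvdef, Equiv.apply_symm_apply]
  have hgood : E.HasGoodReductionAt v := hasGoodReductionAt_B v (by rw [hvp]; exact hp2n)
  have hrec : ∀ k, E.LFunction (p ^ (k + 2)) = E.LFunction p * E.LFunction (p ^ (k + 1)) - (p : ℤ) * E.LFunction (p ^ k) := by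
    intro k
    have h := E.LFunction_apply_prime_pow_add_two v k
    rw [hvp, if_pos hgood] at h
    exact h
  set T : ℕ → R := fun k ↦ ∑ j ∈ Finset.range (k + 1), π ^ j * σ ^ (k - j) with hT
  suffices H : ∀ k, ((E.LFunction (p ^ k) : ℤ) : R) = T k ∧ ((E.LFunction (p ^ (k + 1)) : ℤ) : R) = T (k + 1) from
    (H k).1
  intro k
  induction k with
  | zero =>
    constructor
    · rw [pow_zero, E.isMultiplicative_LFunction.map_one]; simp [hT]
    · rw [zero_add, pow_one, h1]
      simp only [hT, Finset.sum_range_succ, Finset.sum_range_zero, pow_zero, pow_one, Nat.sub_zero, Nat.sub_self,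
        one_mul, mul_one, zero_add]
      ring
  | succ k ih =>
    refine ⟨ih.2, ?_⟩
    rw [show k + 1 + 1 = k + 2 by ring, hrec k, Int.cast_sub, Int.cast_mul, Int.cast_mul, ih.1, ih.2, h1,
      Int.cast_natCast, hpπσ]
    have hTrec : T (k + 2) = (π + σ) * T (k + 1) - π * σ * T k := by
      simp only [hT]; exact GaussianPrimary.sum_pow_mul_pow_rec π σ k
    rw [hTrec]

end Split

end SqrtTwoTwist

end Literature.NumberTheory.EllipticCurves

end
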